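import Mathlib
import HarnessLib
import Summits.HubbardSuperconductivity.HubbardSuperconductivity.Theorems.KLProgrammeKLRegimeBetaSplitExtra0
import Summits.HubbardSuperconductivity.HubbardSuperconductivity.Theorems.KLProgrammeKLRegimeSplitBundleV10

/-!
# Route `KLProgramme` — crux K3, child 1 at SLOT level for the Δ-UV engine slot: `BetaSplitP Pr W` for EVERY bundle whose split slot is implied by
# `BetaSplitAtS2` and whose engine slot implies `EngineBoundsAtV7S` (V10 = V9 + Δ-UV, and any later two-leg/renorm/frameOK re-staging)

Cell gate-hubbard-kl, seat hubbard-kl-k3c1-p2 (child-1 re-closure owner on gen 3).  `EngineBoundsAtV7S` (p1's `…SplitBundleV10`, T2-2's Δ-UV): the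
scale-`0` conjunct of (E2) reads `‖𝒞₀(Qm;k,k′) − U‖ ≤ initDevBar G U + legDressBarQ G P Q U 0 4` (COUNT-FREE: all four legs charged once, k3c2-p3's
correction 17:59Z), the `1 ≤ n` conjuncts are V6's.  Child 1 closes through `betaSplitP_of_extraClauses0` (`…KLRegimeBetaSplitExtra0`) at the family
`𝔛 j = [1 ≤ j]·(thermalBar j + legDressBarQ j·legSliceCountT j) + [j = 0]·legDressBarQ 0 4`, numerals `(sG,sQ,tG,tQ) = (1, 8, 4/3, 48)`: the scale-`0`
term `≤ 4·2·CR·Klam³·U²` is charged ON TOP of the count budget `Σ_{m ≤ N} legSliceCountT ≤ 20` (`tQ: 40 ↦ 48`, `8(tQ+sQ)+tQ = 496 ≤ klLegKappa`;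
`C_W` unchanged (23·CF·Klam²); no-onset `Crow`'s `CR·Klam³` coefficient `48 ↦ 56`).  **`betaSplitP_of_slotsV7S`**; every bundle `klPredsVn` with these
two slots closes child 1 by two identity slot maps.  Everything is proved.
-/

noncomputable section

namespace Summit.HubbardSuperconductivity.HubbardSuperconductivity.Theorems.KLRegimeSplit

set_option linter.dupNamespace false -- summit = problem name (single-conjunct summit), D-0017

open Real Finset Literature.MathematicalPhysics.QuantumLattice Literature.Probability.LatticeModels
open Summit.HubbardSuperconductivity.HubbardSuperconductivity.Theorems.KLProgrammeLegKernels
open Summit.HubbardSuperconductivity.HubbardSuperconductivity.Theorems.CooperChannelRiccatiFlow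
open Summit.HubbardSuperconductivity.HubbardSuperconductivity.Theorems.DispersionFlow

/-- **Child 1 at slot level for the V7S (Δ-UV) engine slot, every bundle and window.**  If `BetaSplitAtS2 ⇒ Pr.split` and
`Pr.engine ⇒ EngineBoundsAtV7S`, then `BetaSplitP Pr W`. -/
theorem betaSplitP_of_slotsV7S {Pr : Preds} {W : Set ℝ}
    (hs : ∀ (L M : ℕ) [NeZero L] [NeZero M] (G : GeoConsts) (P : SplitConsts) (Q : EngConsts) (β U μ : ℝ) (K : TrigPolyC4v) (n : ℕ),
      BetaSplitAtS2 L M G P Q β U μ K n → Pr.split L M G P Q β U μ K n)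
    (he : ∀ (L M : ℕ) [NeZero L] [NeZero M] (G : GeoConsts) (P : SplitConsts) (Q : EngConsts) (β U μ : ℝ) (K : TrigPolyC4v) (n : ℕ),
      Pr.engine L M G P Q β U μ K n → EngineBoundsAtV7S L M G P Q β U μ K n) :
    BetaSplitP Pr W := by
  refine betaSplitP_of_extraClauses0 (Pr := Pr) (sG := 1) (sQ := 8) (tG := 4 / 3) (tQ := 48) zero_le_one (by norm_num)
    (by norm_num) (by norm_num) (by unfold klLegKappa; norm_num)
    (fun L G P Q β U μ K j Qm k k' =>
      if 1 ≤ j then thermalBar G P U β j + legDressBarQ G P Q U j (legSliceCountT L β μ K j ![k', Qm - k', Qm - k, k])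
      else legDressBarQ G P Q U 0 4)
    ?_ ?_ ?_ ?_ hs ?_
  · -- nonnegativity
    intro L G P Q β U μ K j Qm k k' hG hP hQ
    have hCF : 0 ≤ G.CF := hG.2.2.2.2.2.2.2.2.2.2.2.2.2.1
    have hK0 : 0 ≤ P.Klam := zero_le_one.trans hP.1
    split_ifs
    · exact add_nonneg (thermalBar_nonneg hCF P U β j) (legDressBarQ_nonneg G hK0 hQ.2.1 U j _)
    · exact legDressBarQ_nonneg G hK0 hQ.2.1 U 0 _
  · -- per-scale size (both branches `≤ CF(Klam U)² + 8·CR·Klam³·U²`)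
    intro L G P Q β U μ K j Qm k k' hG hP hQ hU hU1
    have hCF : 0 ≤ G.CF := hG.2.2.2.2.2.2.2.2.2.2.2.2.2.1
    have hK0 : 0 ≤ P.Klam := zero_le_one.trans hP.1
    have hCR : 0 ≤ Q.CR := hQ.2.1
    have hcr3 := cr3_le hP.1 hCR hU1
    have hq30 : 0 ≤ Q.CR * P.Klam ^ 3 * U ^ 2 := by positivity
    have hg20 : 0 ≤ G.CF * (P.Klam * U) ^ 2 := by positivity
    split_ifs with hj
    · have h1 := thermalBar_le hCF P U β j
      have h2 := legDressBarQ_le G hK0 hCR U j (legSliceCountT L β μ K j ![k', Qm - k', Qm - k, k])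
      have h4 : (legSliceCountT L β μ K j ![k', Qm - k', Qm - k, k] : ℝ) ≤ 4 := by
        exact_mod_cast legSliceCountT_le_four L β μ K j _
      have h3 : Q.CR * ((P.Klam * U) ^ 2 + (P.Klam * |U|) ^ 3) * (legSliceCountT L β μ K j ![k', Qm - k', Qm - k, k] : ℝ) ≤
          2 * Q.CR * P.Klam ^ 3 * U ^ 2 * 4 := mul_le_mul hcr3 h4 (Nat.cast_nonneg _) (by positivity)
      linarith
    · have h2 := legDressBarQ_le G hK0 hCR U 0 4
      have h3 : Q.CR * ((P.Klam * U) ^ 2 + (P.Klam * |U|) ^ 3) * ((4 : ℕ) : ℝ) ≤ 2 * Q.CR * P.Klam ^ 3 * U ^ 2 * 4 := by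
        rw [Nat.cast_ofNat]; nlinarith [hcr3]
      linarith
  · -- scale sums over `(t, n]` (only inductive scales occur: `j > t ≥ 0`)
    intro L G P Q β U μ K t n Qm k k' hG hP hQ hU hU1 hn
    have hCF : 0 ≤ G.CF := hG.2.2.2.2.2.2.2.2.2.2.2.2.2.1
    have hK0 : 0 ≤ P.Klam := zero_le_one.trans hP.1
    have hcr3 := cr3_le hP.1 hQ.2.1 hU1
    have hq30 : 0 ≤ Q.CR * P.Klam ^ 3 * U ^ 2 := by have := hQ.2.1; positivity
    have heq : ∀ j ∈ Ioc t n, (if 1 ≤ j then thermalBar G P U β j +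
        legDressBarQ G P Q U j (legSliceCountT L β μ K j ![k', Qm - k', Qm - k, k]) else legDressBarQ G P Q U 0 4) =
        thermalBar G P U β j + legDressBarQ G P Q U j (legSliceCountT L β μ K j ![k', Qm - k', Qm - k, k]) := by
      intro j hj
      simp only [mem_Ioc] at hj
      rw [if_pos (by omega)]
    rw [sum_congr rfl heq, sum_add_distrib]
    have hsub : ∀ (f : ℕ → ℝ), (∀ j, 0 ≤ f j) → ∑ j ∈ Ioc t n, f j ≤ ∑ j ∈ range (n + 1), f j := fun f hf =>
      sum_le_sum_of_subset_of_nonneg (fun j hj => by simp only [mem_Ioc] at hj; exact mem_range.2 (by omega)) fun j _ _ => hf j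
    have h1 : ∑ j ∈ Ioc t n, thermalBar G P U β j ≤ 4 / 3 * (G.CF * (P.Klam * U) ^ 2) :=
      (hsub _ fun j => thermalBar_nonneg hCF P U β j).trans (thermalBar_sum_le hCF P U β hn)
    have h2 : ∑ j ∈ Ioc t n, legDressBarQ G P Q U j (legSliceCountT L β μ K j ![k', Qm - k', Qm - k, k]) ≤
        20 * (2 * Q.CR * P.Klam ^ 3 * U ^ 2) :=
      ((hsub _ fun j => legDressBarQ_nonneg G hK0 hQ.2.1 U j _).trans
          (legDressBarQ_countT_sum_le L G hK0 hQ.2.1 U β μ K _ n)).trans (by nlinarith [hcr3])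
    linarith
  · -- scale sums `m ≤ n`: the scale-0 term plus the shifted inductive sums
    intro L G P Q β U μ K n Qm k k' hG hP hQ hU hU1 hn
    have hCF : 0 ≤ G.CF := hG.2.2.2.2.2.2.2.2.2.2.2.2.2.1
    have hK0 : 0 ≤ P.Klam := zero_le_one.trans hP.1
    have hCR : 0 ≤ Q.CR := hQ.2.1
    have hcr3 := cr3_le hP.1 hCR hU1
    have hq30 : 0 ≤ Q.CR * P.Klam ^ 3 * U ^ 2 := by positivity
    have heq : ∀ i ∈ range n, (if 1 ≤ i + 1 then thermalBar G P U β (i + 1) +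
        legDressBarQ G P Q U (i + 1) (legSliceCountT L β μ K (i + 1) ![k', Qm - k', Qm - k, k]) else legDressBarQ G P Q U 0 4) =
        thermalBar G P U β (i + 1) + legDressBarQ G P Q U (i + 1) (legSliceCountT L β μ K (i + 1) ![k', Qm - k', Qm - k, k]) :=
      fun i _ => by rw [if_pos (by omega)]
    rw [if_neg (by omega), sum_congr rfl heq, sum_add_distrib]
    have h0 := legDressBarQ_le G hK0 hCR U 0 4
    have h0' : Q.CR * ((P.Klam * U) ^ 2 + (P.Klam * |U|) ^ 3) * ((4 : ℕ) : ℝ) ≤ 2 * Q.CR * P.Klam ^ 3 * U ^ 2 * 4 := by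
      rw [Nat.cast_ofNat]; nlinarith [hcr3]
    have h1 : ∑ i ∈ range n, thermalBar G P U β (i + 1) ≤ 4 / 3 * (G.CF * (P.Klam * U) ^ 2) :=
      (sum_range_succ_shift_le (f := fun m => thermalBar G P U β m) (fun m => thermalBar_nonneg hCF P U β m) n).trans
        (thermalBar_sum_le hCF P U β hn)
    have h2 : ∑ i ∈ range n, legDressBarQ G P Q U (i + 1) (legSliceCountT L β μ K (i + 1) ![k', Qm - k', Qm - k, k]) ≤
        20 * (2 * Q.CR * P.Klam ^ 3 * U ^ 2) :=
      ((sum_range_succ_shift_le (f := fun m => legDressBarQ G P Q U m (legSliceCountT L β μ K m ![k', Qm - k', Qm - k, k]))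
          (fun m => legDressBarQ_nonneg G hK0 hQ.2.1 U m _) n).trans
          (legDressBarQ_countT_sum_le L G hK0 hQ.2.1 U β μ K _ n)).trans (by nlinarith [hcr3])
    linarith
  · -- the engine slot yields `EngineBoundsAtV7S`: project the four clauses child 1 reads
    intro L M _ _ G P Q β U μ K n h
    have h' : EngineBoundsAtV7S L M G P Q β U μ K n := he L M G P Q β U μ K n h
    refine ⟨fun hn0 Qm k hk k' hk' => ?_, fun hn1 Qm hQ => ?_, fun hn1 Qm k hk k' hk' => ?_, h'.2.2.2.2.2.2.1, h'.2.2.2.2.2.2.2⟩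
    · rw [if_neg (by omega)]
      exact h'.2.2.1.1 hn0 Qm k hk k' hk'
    · obtain ⟨w, hw0, hws, N, hN, hb⟩ := h'.2.2.1.2 hn1 Qm hQ
      exact ⟨w, hw0, hws, N, hN, fun k hk k' hk' => (hb k hk k' hk').trans (le_of_eq (by rw [if_pos hn1]; ring))⟩
    · exact (h'.2.2.2.1 hn1 Qm k hk k' hk').trans (le_of_eq (by rw [if_pos hn1]; ring))

end Summit.HubbardSuperconductivity.HubbardSuperconductivity.Theorems.KLRegimeSplit

end
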